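import Literature.Analysis.FluidPDE.SteadyNSLiouvilleVorticityReduction
import Literature.Analysis.FluidPDE.SteadyNSLiouvilleL3AnnulusProofs
import HarnessLib

/-!
# Wang–Yang 2026, Theorems 1.5 and 1.6: the discharges

Analysis/FluidPDE proof file (everything PROVED, no definitions, no named facts). It **discharges**
the two named facts of `SteadyNSLiouville.lean` vendored from W. Wang, G. Yang, *New decay
estimates and Liouville type theorems for the 3D axisymmetric stationary Navier–Stokes
equations*, arXiv:2608.06040 (2026):

* `wangYang2026_liouville_velocity_log_holds` — **Theorem 1.5** (p. 5; proof §4, p. 19): a smooth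
  steady solution of `−Δu + (u·∇)u + ∇p = 0`, `div u = 0` on `ℝ³` with finite Dirichlet integral,
  `u → 0` at infinity and `|u(x)| ≤ C r^{-2/3} (log(e + r))^{-γ}` for `r ≥ 1`, some `γ > 1/3`
  (`r` the distance to the `x₃`-axis), vanishes identically. As printed, Theorem 1.5 is the case
  `q = ℓ = 3` of Seregin–Wang 2020, Thm 1.1 (i) once `‖u‖_{L³(B_R ∖ B_{R/2})} → 0` is checked
  ((1.13)–(1.14), p. 19): the tree's `wangYang2026_liouville_velocity_log_of_sereginWang`
  (`SteadyNSLiouvilleProofs`) composed with the discharge `sereginWang_liouville_L3_annulus_holds`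
  (`SteadyNSLiouvilleL3AnnulusProofs`).
* `wangYang2026_liouville_vorticity_log_holds` — **Theorem 1.6** (p. 5; proof = Prop. 4.2,
  pp. 19–22 + Lemma A.2, pp. 22–24): the same conclusion under the vorticity bound
  `|ω(x)| ≤ C r^{-5/3} (log(e + r))^{-γ}` for `r ≥ 1`, `γ > 1/3`; by the tree's
  `wangYang2026_liouville_vorticity_log_of_velocity_log` (`SteadyNSLiouvilleVorticityReduction`:
  the velocity envelope of Prop. 4.2 via the Green identity `SteadyNSLiouvilleGreen`, the log
  weights `SteadyNSLiouvilleLogWeights`, the planar potential Lemma A.2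
  `SteadyNSLiouvillePlanarPotential` and the transfer estimates
  `SteadyNSLiouvilleVorticityTransfer`) applied to Theorem 1.5.

## References

* W. Wang, G. Yang, arXiv:2608.06040 (2026), Thms 1.5, 1.6, Prop. 4.2, Lemma A.2. [WangYang2026]
* G. Seregin, W. Wang, St. Petersburg Math. J. 31 (2020) = arXiv:1805.02227, Thm 1.1 (i).
  [SereginWang2020]
-/

namespace Literature.Analysis.FluidPDE

/-- **Wang–Yang 2026, Theorem 1.5** (discharge of `wangYang2026_liouville_velocity_log`): Liouville
theorem for smooth steady `D`-solutions of the Navier–Stokes equations on `ℝ³` decaying like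
`|u| ≤ C r^{-2/3}(log(e + r))^{-γ}`, `γ > 1/3`, off the unit tube around the `x₃`-axis — via
Seregin–Wang 2020, Thm 1.1 (i) (`q = ℓ = 3`). [cite: WangYang2026, Thm 1.5 (p. 5; proof p. 19)] -/
theorem wangYang2026_liouville_velocity_log_holds : wangYang2026_liouville_velocity_log :=
  wangYang2026_liouville_velocity_log_of_sereginWang sereginWang_liouville_L3_annulus_holds

/-- **Wang–Yang 2026, Theorem 1.6** (discharge of `wangYang2026_liouville_vorticity_log`):
Liouville theorem for smooth steady `D`-solutions of the Navier–Stokes equations on `ℝ³` whose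
vorticity decays like `|ω| ≤ C r^{-5/3}(log(e + r))^{-γ}`, `γ > 1/3`, off the unit tube around the
`x₃`-axis — reduced to Theorem 1.5 by the velocity envelope of Prop. 4.2.
[cite: WangYang2026, Thm 1.6 (p. 5; proof Prop. 4.2 pp. 19–22, Lemma A.2 pp. 22–24)] -/
theorem wangYang2026_liouville_vorticity_log_holds : wangYang2026_liouville_vorticity_log :=
  wangYang2026_liouville_vorticity_log_of_velocity_log wangYang2026_liouville_velocity_log_holds

end Literature.Analysis.FluidPDE
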